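import Summits.AtomisticToContinuum.FouriersLaw.Theorems.LocalOhmBVLocalOhmStubGibbsTermCovarianceDecayAux6

/-!
# Stub `stub_gibbsTermCovarianceDecay` (T2) of the birth line of crux `LocalOhmBV.LocalOhm`

Crux item stmt-AtomisticToContinuum-12009 (`Summit.AtomisticToContinuum.FouriersLaw.Theses.LocalOhmBV.LocalOhm`),
line `registered` (birth; reshaped by lead c4: S2b♭ replaced by the per-observable window–energy
covariance bound T1 ∘ T2). This file proves T2, the PER-TERM EXPONENTIAL DECAY, uniformly in the
length `N` and in the window position, of the covariance under the free finite-volume Gibbs state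
`gibbsMeasure N T = Z⁻¹ e^{-H_N/T} dq dp` of `pinnedChain ω₂ lam β γ` between a continuous polynomially
bounded window observable `G = g ∘ boxRestrictAt a n ∘ embed N c` (finite sites `a+c, …, a+c+n`) and
one potential-energy term at distance `≥ d` to the RIGHT of the window — the pinning energy `U(q_t)`
and the bond energy `V(q_{t+1} - q_t)`, `a+c+n+d ≤ t`: `|Cov_N(G, u_t)| ≤ C rᵈ` with `C ≥ 0`,
`0 ≤ r < 1` depending on the parameters, `T`, `n`, `g` only (Cassandro–Olivieri–Pellegrinotti–Presutti
1978 §3, in the free finite volume).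

Proof (helper files `…StubGibbsTermCovarianceDecayAux1–6`). SYMMETRISED TRANSFER OPERATOR on the
one-site phase space `Y = ℝ × ℝ`: `a = e^{-(p²/2+U(q))/4T}`, a priori measure `ρ = a² dq dp` (finite),
kernel `k(z, z') = a(z) e^{-V(q'-q)/T} a(z')` (continuous, symmetric, `0 < k ≤ 1`), so that the
insertion kernels `k · U(q')`, `k · V(q'-q)` are BOUNDED (`U a ≤ 4T`, `V e^{-V/T} ≤ T`) and the tree's
`Literature.Analysis.OperatorTheory.exists_transferOperator` / `exists_kernelOp` give the `L²(ρ)`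
operators `A`, `H_U`, `H_V`; Jentzsch's gap `‖Aⁿ g - λⁿ⟪φ, g⟫φ‖ ≤ θⁿ‖g‖`
(`IsPositivityImproving.exists_norm_pow_sub_le`). TRANSPORT (`Aux1`, `Aux4`): Lebesgue measure on
`PhaseSpace N` is `(ℝ × ℝ)^N` (Mathlib's volume-preserving `arrowProdEquivProdArrow`) and
`e^{-H_N/T} = w_N · ∏ a²` with the weight `w_N` written, like `hamiltonian`, as a nearest-neighbour
double product, so `∫ F e^{-H_N/T} = ∫ F w_N dρ^{⊗N}` uniformly in `N`. REPRESENTATION (`Aux2`, `Aux3`):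
splitting `(ℝ × ℝ)^{e+1+m}` along `Fin.append` (window block | right block) and freezing the last window
site (`Fin.snoc`), `Z_N E_N[G u] = ⟪[Ĝ], Aʲ H A^{m-1-j}[a]⟫`, `Z_N E_N[G] = ⟪[Ĝ], Aᵐ[a]⟫`, and the
same with `G = 1` (`SpecificHeatLimit.hetPath_spec` for the right block), the left vector `Ĝ ∈ L²(ρ)`
with `∫ Ĝ² dρ ≤ Z_e Z_{e+1} E_{e+1}[G²]` by Cauchy–Schwarz and `K₀ ≤ 1` (un-normalised Gibbs integrals
of SHORTER chains; no pointwise division by `φ`). GAP (`Aux5`): in the covariance determinant the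
rank-one parts cancel, `|⟪g, Aʲx⟫⟪l, Aʲy⟫ - ⟪g, Aʲy⟫⟪l, Aʲx⟫| ≤ 6 λʲθʲ ‖g‖‖l‖‖x‖‖y‖`; the partition
functions obey `Z_N ≥ z_* λ^{N-1}` for ALL `N` (positivity + `Z_N/λ^{N-1} → ⟪φ, [a]⟫² > 0`) and
`Z_M ≤ 2λ^{M-1}‖[a]‖²`; all powers of `λ` cancel, leaving `C(g) (θ/λ)ʲ` with `j ≥ d - 1`.
`N`-uniform window second moments: `LocalOhmBirth.pinnedChain_gibbsMeasure_window_sq_le`. The one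
degenerate configuration (pinning term AT the last window site, `d = 0`) is Cauchy–Schwarz with the
`N`-uniform moments of `U(q_t)²`. The rate is `r = max(θ/λ, 1/2)`.
-/

set_option autoImplicit false

noncomputable section

namespace Summit.AtomisticToContinuum.FouriersLaw.Theorems.LocalOhmBirth

open MeasureTheory Filter Topology
open scoped BigOperators RealInnerProductSpace
open Literature.MathematicalPhysics.KineticTheory.HeatConduction
open Literature.Analysis.OperatorTheory
open Summit.AtomisticToContinuum.FouriersLaw.Theorems.WindowLimit (embed)
open Summit.AtomisticToContinuum.FouriersLaw.Theorems.LocalOhmBirth.TermDecay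

/-- `rʲ ≤ 2 rᵈ` for `1/2 ≤ r ≤ 1` and `d ≤ j + 1`. -/
theorem pow_le_two_mul_pow {r : ℝ} (hr : 1 / 2 ≤ r) (hr1 : r ≤ 1) {d j : ℕ} (h : d ≤ j + 1) :
    r ^ j ≤ 2 * r ^ d := by
  have hr0 : 0 ≤ r := by linarith
  rcases Nat.eq_zero_or_pos d with hd | hd
  · subst hd
    rw [pow_zero, mul_one]
    exact (pow_le_one₀ hr0 hr1).trans (by norm_num)
  · obtain ⟨d', rfl⟩ : ∃ d', d = d' + 1 := ⟨d - 1, by omega⟩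
    calc r ^ j ≤ r ^ d' := pow_le_pow_of_le_one hr0 hr1 (by omega)
      _ = r ^ d' * 1 := (mul_one _).symm
      _ ≤ r ^ d' * (2 * r) := mul_le_mul_of_nonneg_left (by linarith) (pow_nonneg hr0 _)
      _ = 2 * r ^ (d' + 1) := by ring

/-- **Cauchy–Schwarz fallback** for a covariance under a probability measure:
`|∫ F G - ∫ F ∫ G| ≤ 2 √K_F √K_G` when `∫ F² ≤ K_F`, `∫ G² ≤ K_G`. -/
theorem abs_integral_mul_sub_le_two_mul_sqrt {Ω : Type*} [MeasurableSpace Ω] {μ : Measure Ω}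
    [IsProbabilityMeasure μ] {F G : Ω → ℝ} (hF : MemLp F 2 μ) (hG : MemLp G 2 μ) {KF KG : ℝ}
    (hKF : ∫ x, F x ^ 2 ∂μ ≤ KF) (hKG : ∫ x, G x ^ 2 ∂μ ≤ KG) :
    |∫ x, F x * G x ∂μ - (∫ x, F x ∂μ) * (∫ x, G x ∂μ)| ≤ 2 * Real.sqrt KF * Real.sqrt KG := by
  set f : Lp ℝ 2 μ := hF.toLp F with hfdef
  set g' : Lp ℝ 2 μ := hG.toLp G with hgdef
  have h1m : MemLp (fun _ : Ω => (1 : ℝ)) 2 μ := memLp_const (1 : ℝ)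
  set o : Lp ℝ 2 μ := h1m.toLp (fun _ : Ω => (1 : ℝ)) with hodef
  have hf : ‖f‖ ≤ Real.sqrt KF :=
    Real.le_sqrt_of_sq_le (by rw [hfdef, norm_toLp_sq_eq_integral_sq hF]; exact hKF)
  have hg' : ‖g'‖ ≤ Real.sqrt KG :=
    Real.le_sqrt_of_sq_le (by rw [hgdef, norm_toLp_sq_eq_integral_sq hG]; exact hKG)
  have ho : ‖o‖ ≤ 1 := by
    have h : ‖o‖ ^ 2 ≤ 1 := by
      rw [hodef, norm_toLp_sq_eq_integral_sq h1m]
      simp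
    simpa using Real.le_sqrt_of_sq_le h
  have h1 : ∫ x, F x * G x ∂μ = ⟪f, g'⟫ := by
    rw [inner_eq_integral]
    exact integral_congr_ae (by
      filter_upwards [hF.coeFn_toLp, hG.coeFn_toLp] with x hx hy
      rw [hx, hy])
  have h2 : ∫ x, F x ∂μ = ⟪f, o⟫ := by
    rw [inner_eq_integral]
    exact integral_congr_ae (by
      filter_upwards [hF.coeFn_toLp, h1m.coeFn_toLp] with x hx ho'
      rw [hx, ho', mul_one])
  have h3 : ∫ x, G x ∂μ = ⟪o, g'⟫ := by
    rw [inner_eq_integral]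
    exact integral_congr_ae (by
      filter_upwards [hG.coeFn_toLp, h1m.coeFn_toLp] with x hx ho'
      rw [hx, ho', one_mul])
  rw [h1, h2, h3]
  calc |⟪f, g'⟫ - ⟪f, o⟫ * ⟪o, g'⟫| ≤ |⟪f, g'⟫| + |⟪f, o⟫ * ⟪o, g'⟫| := abs_sub _ _
    _ ≤ ‖f‖ * ‖g'‖ + (‖f‖ * ‖o‖) * (‖o‖ * ‖g'‖) := by
        refine add_le_add (abs_real_inner_le_norm _ _) ?_
        rw [abs_mul]
        exact mul_le_mul (abs_real_inner_le_norm _ _) (abs_real_inner_le_norm _ _) (abs_nonneg _)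
          (by positivity)
    _ ≤ Real.sqrt KF * Real.sqrt KG + (Real.sqrt KF * 1) * (1 * Real.sqrt KG) := by gcongr
    _ = 2 * Real.sqrt KF * Real.sqrt KG := by ring

set_option maxHeartbeats 1600000 in
/-- **T2 `stub_gibbsTermCovarianceDecay`** (per-term exponential decay of window–energy-term
covariances under the free finite-volume Gibbs state of the pinned anharmonic chain, right side,
uniformly in the length and the window position). For `ω₂, lam, β, γ > 0`, `T > 0`, a window size `n`
and a continuous polynomially bounded profile `g` there are `C ≥ 0` and `0 ≤ r < 1` such that for
every length `N`, every window `{a+c, …, a+c+n} ⊆ [0, N)` and every site `t` with `a+c+n+d ≤ t`: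
`|Cov_{Gibbs_N}(g ∘ boxRestrictAt a n ∘ embed N c, U(q_t))| ≤ C rᵈ` and, for `t' = t+1 < N`,
`|Cov_{Gibbs_N}(g ∘ boxRestrictAt a n ∘ embed N c, V(q_{t'} - q_t))| ≤ C rᵈ`. Proof: see the module
docstring (symmetrised transfer operator on `L²(a² dq dp)`, Jentzsch gap, block representation as
`L²` pairings, cancellation of the rank-one parts; `pinnedChain_abs_cov_window_insertion_le`). -/
theorem stub_gibbsTermCovarianceDecay :
    ∀ ω₂ lam β γ : ℝ, 0 < ω₂ → 0 < lam → 0 < β → 0 < γ → ∀ T : ℝ, 0 < T →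
    ∀ (n : ℕ) (g : (Fin (n + 1) → ℝ × ℝ) → ℝ), Continuous g →
    (∃ (C₀ : ℝ) (m : ℕ), ∀ y, |g y| ≤ C₀ * (1 + ‖y‖) ^ m) →
    ∃ (C r : ℝ), 0 ≤ C ∧ 0 ≤ r ∧ r < 1 ∧
      ∀ (N c : ℕ) (a : ℤ), 0 ≤ a + c → a + c + n < N →
      ∀ (t : Fin N) (d : ℕ), a + c + n + d ≤ (t.val : ℤ) →
        |(∫ z, g (boxRestrictAt a n (embed N c z)) * (pinnedChain ω₂ lam β γ).U (z.1 t) ∂((pinnedChain ω₂ lam β γ).gibbsMeasure N T)) -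
            (∫ z, g (boxRestrictAt a n (embed N c z)) ∂((pinnedChain ω₂ lam β γ).gibbsMeasure N T)) * (∫ z, (pinnedChain ω₂ lam β γ).U (z.1 t) ∂((pinnedChain ω₂ lam β γ).gibbsMeasure N T))| ≤
          C * r ^ d ∧
        ∀ t' : Fin N, t'.val = t.val + 1 →
        |(∫ z, g (boxRestrictAt a n (embed N c z)) * (pinnedChain ω₂ lam β γ).V (z.1 t' - z.1 t) ∂((pinnedChain ω₂ lam β γ).gibbsMeasure N T)) -
            (∫ z, g (boxRestrictAt a n (embed N c z)) ∂((pinnedChain ω₂ lam β γ).gibbsMeasure N T)) * (∫ z, (pinnedChain ω₂ lam β γ).V (z.1 t' - z.1 t) ∂((pinnedChain ω₂ lam β γ).gibbsMeasure N T))| ≤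
          C * r ^ d := by
  intro ω₂ lam β γ hω hl hβ _hγ T hT n g hg hgb
  obtain ⟨C₀, mg, hgb⟩ := hgb
  set P := pinnedChain ω₂ lam β γ with hP
  -- ### transfer data on the one-site phase space `ℝ × ℝ`
  obtain ⟨a, ha⟩ : ∃ a : ℝ × ℝ → ℝ, ∀ z, a z = Real.exp (-(z.2 ^ 2 / 2 + P.U z.1) / (4 * T)) :=
    ⟨_, fun _ => rfl⟩
  obtain ⟨K₀, hK₀⟩ : ∃ K₀ : ℝ × ℝ → ℝ × ℝ → ℝ, ∀ z z', K₀ z z' = Real.exp (-P.V (z'.1 - z.1) / T) :=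
    ⟨_, fun _ _ => rfl⟩
  obtain ⟨k, hk⟩ : ∃ k : ℝ × ℝ → ℝ × ℝ → ℝ, ∀ z z', k z z' = a z * K₀ z z' * a z' := ⟨_, fun _ _ => rfl⟩
  obtain ⟨w, hw⟩ : ∃ w : (N : ℕ) → (Fin N → ℝ × ℝ) → ℝ, ∀ (N : ℕ) (ζ : Fin N → ℝ × ℝ),
      w N ζ = (∏ i, a (ζ i) ^ 2) *
        ∏ i : Fin N, ∏ j : Fin N, if j.val = i.val + 1 then K₀ (ζ i) (ζ j) else 1 :=
    ⟨fun N ζ => (∏ i, a (ζ i) ^ 2) *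
        ∏ i : Fin N, ∏ j : Fin N, if j.val = i.val + 1 then K₀ (ζ i) (ζ j) else 1, fun _ _ => rfl⟩
  obtain ⟨ρ, hρ⟩ : ∃ ρ : Measure (ℝ × ℝ), ρ = volume.withDensity fun z => ENNReal.ofReal (a z ^ 2) :=
    ⟨_, rfl⟩
  haveI : IsFiniteMeasure ρ := isFiniteMeasure_siteMeasure₂ hω hl.le hT ha hρ
  have hρ0 : ρ ≠ 0 := siteMeasure_ne_zero₂ hω hl.le hT ha hρ
  obtain ⟨-, ham, -, -, hab, -⟩ := siteWeight_props₂ (β := β) (γ := γ) hω.le hl.le hT ha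
  obtain ⟨-, -, -, -, -, hkc, hksymm, hkpos, hk1⟩ := transferKernel_props₂ hω.le hl.le hβ.le hT ha hK₀ hk
  obtain ⟨hkUc, hkUb, hkVc, hkVb⟩ := insertion_bounds₂ hω.le hl.le hβ.le hT ha hK₀ hk
  set Cb : ℝ := max 1 (4 * T) with hCb
  have hkCb : ∀ x y, ‖k x y‖ ≤ Cb := fun x y => (hk1 x y).trans (le_max_left _ _)
  have hkUCb : ∀ x y, ‖k x y * P.U y.1‖ ≤ Cb := fun x y => (hkUb x y).trans (le_max_right _ _)
  have hkVCb : ∀ x y, ‖k x y * P.V (y.1 - x.1)‖ ≤ Cb := fun x y =>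
    (hkVb x y).trans ((by linarith : T ≤ 4 * T).trans (le_max_right _ _))
  -- ### the operators and the Jentzsch gap
  obtain ⟨A, hA, hsa, hcomp, himp, hA0⟩ :=
    exists_transferOperator (μ := ρ) hkc.stronglyMeasurable hkCb hksymm hkpos hρ0
  obtain ⟨HU, hHU⟩ := exists_kernelOp (μ := ρ) hkUc.stronglyMeasurable hkUCb
  obtain ⟨HV, hHV⟩ := exists_kernelOp (μ := ρ) hkVc.stronglyMeasurable hkVCb
  obtain ⟨φ, hφ1, hφpos, -, θ, hθ0, hθ, hpow⟩ := himp.exists_norm_pow_sub_le hsa hcomp hA0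
  set lam₀ : ℝ := ‖A‖ with hlam₀def
  have hlam₀ : 0 < lam₀ := norm_pos_iff.2 hA0
  -- ### the boundary vector and the partition functions
  set b : Lp ℝ 2 ρ := (memLp_two_of_bound (μ := ρ) ham hab).toLp a with hbdef
  have hb : (b : ℝ × ℝ → ℝ) =ᵐ[ρ] a := (memLp_two_of_bound (μ := ρ) ham hab).coeFn_toLp
  obtain ⟨-, -, hapos, -, -, -⟩ := siteWeight_props₂ (β := β) (γ := γ) hω.le hl.le hT ha
  have hbpos : IsStrictlyPositiveFun b := by
    unfold IsStrictlyPositiveFun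
    filter_upwards [hb] with x hx
    rw [hx]; exact hapos x
  have hbP : IsPositiveFun b := hbpos.isPositiveFun hρ0
  have hc0 : 0 < ⟪φ, b⟫ := by rw [real_inner_comm]; exact inner_pos hbP hφpos
  have hAnP : ∀ n, IsPositiveFun ((A ^ n) b) := by
    intro n
    induction n with
    | zero => simpa using hbP
    | succ n ih => rw [pow_succ', mul_apply_eq_comp]; exact (himp _ ih).isPositiveFun hρ0
  have hZpos' : ∀ n, 0 < ⟪b, (A ^ n) b⟫ := fun n =>
    calc (0 : ℝ) < ⟪(A ^ n) b, b⟫ := inner_pos (hAnP n) hbpos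
      _ = ⟪b, (A ^ n) b⟫ := real_inner_comm _ _
  have hzt : Tendsto (fun n => ⟪b, (A ^ n) b⟫ / lam₀ ^ n) atTop (𝓝 (⟪φ, b⟫ ^ 2)) :=
    SpecificHeatLimit.tendsto_inner_pow_div hlam₀ hθ0 hθ hpow
  obtain ⟨zs, hzs0, -, hzsle⟩ := SpecificHeatLimit.exists_pos_le_of_tendsto
    (fun n => div_pos (hZpos' n) (pow_pos hlam₀ n)) (by positivity) hzt
  have hz : ∀ n, zs * lam₀ ^ n ≤ ⟪b, (A ^ n) b⟫ := fun n =>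
    (le_div_iff₀ (pow_pos hlam₀ n)).1 (hzsle n)
  -- ### Gibbs-side constants
  obtain ⟨KG, hKG0, hKGw⟩ := pinnedChain_gibbsMeasure_window_sq_le γ hω hl.le hβ.le hT n hg hgb
  obtain ⟨KU, hKU0, hKU⟩ := pinnedChain_gibbsMeasure_U_sq_le γ hω hl.le hβ.le hT
  -- ### the constants
  set r : ℝ := max (θ / lam₀) (1 / 2) with hr
  have hr0 : 0 ≤ r := le_max_of_le_right (by norm_num)
  have hrhalf : 1 / 2 ≤ r := le_max_right _ _
  have hr1 : r < 1 := max_lt ((div_lt_one hlam₀).2 hθ) (by norm_num)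
  have hθr : θ / lam₀ ≤ r := le_max_left _ _
  have hθl0 : 0 ≤ θ / lam₀ := div_nonneg hθ0 hlam₀.le
  set BZ : ℝ := max (4 * ‖b‖ ^ 4 / lam₀) (2 * ‖b‖ ^ 2) with hBZ
  have hBZ0 : 0 ≤ BZ := le_max_of_le_right (by positivity)
  set CH : ℝ := max ‖HU‖ ‖HV‖ with hCH
  have hCH0 : 0 ≤ CH := le_max_of_le_left (norm_nonneg _)
  set Cm : ℝ := 24 * Real.sqrt KG * BZ * CH * ‖b‖ ^ 2 / (zs ^ 2 * lam₀) with hCm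
  have hCm0 : 0 ≤ Cm := by positivity
  set Cfb : ℝ := 2 * Real.sqrt KG * Real.sqrt KU with hCfb
  have hCfb0 : 0 ≤ Cfb := by positivity
  -- how the per-insertion bound feeds the final constant
  have hfeed : ∀ (H : Lp ℝ 2 ρ →L[ℝ] Lp ℝ 2 ρ) (jn d : ℕ), ‖H‖ ≤ CH → d ≤ jn + 1 →
      24 * Real.sqrt KG * BZ * ‖H‖ * ‖b‖ ^ 2 * (θ / lam₀) ^ jn / (zs ^ 2 * lam₀) ≤
        max Cfb (2 * Cm) * r ^ d := by
    intro H jn d hH hdj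
    have hq : (θ / lam₀) ^ jn ≤ 2 * r ^ d :=
      (pow_le_pow_left₀ hθl0 hθr jn).trans (pow_le_two_mul_pow hrhalf hr1.le hdj)
    have hK' : 0 ≤ 24 * Real.sqrt KG * BZ * ‖b‖ ^ 2 / (zs ^ 2 * lam₀) := by positivity
    calc 24 * Real.sqrt KG * BZ * ‖H‖ * ‖b‖ ^ 2 * (θ / lam₀) ^ jn / (zs ^ 2 * lam₀)
        = (24 * Real.sqrt KG * BZ * ‖b‖ ^ 2 / (zs ^ 2 * lam₀)) * (‖H‖ * (θ / lam₀) ^ jn) := by ring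
      _ ≤ (24 * Real.sqrt KG * BZ * ‖b‖ ^ 2 / (zs ^ 2 * lam₀)) * (CH * (2 * r ^ d)) :=
          mul_le_mul_of_nonneg_left (mul_le_mul hH hq (pow_nonneg hθl0 _) hCH0) hK'
      _ = (2 * Cm) * r ^ d := by rw [hCm]; ring
      _ ≤ max Cfb (2 * Cm) * r ^ d := mul_le_mul_of_nonneg_right (le_max_right _ _) (pow_nonneg hr0 _)
  refine ⟨max Cfb (2 * Cm), r, le_max_of_le_left hCfb0, hr0, hr1, ?_⟩
  intro N c a0 hac hacn t d htd
  -- ### the window in finite coordinates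
  obtain ⟨a', ha'⟩ : ∃ a' : ℕ, (a' : ℤ) = a0 + c := ⟨(a0 + c).toNat, Int.toNat_of_nonneg hac⟩
  have hwin_eq : ∀ z : PhaseSpace N, g (boxRestrictAt a0 n (embed N c z)) =
      g (fun jj : Fin (n + 1) => (z.1 ⟨a' + jj.val, by omega⟩, z.2 ⟨a' + jj.val, by omega⟩)) := by
    intro z
    rw [WindowLimit.boxRestrictAt_embed N c ha'.symm (by omega)]
    rfl
  simp_rw [hwin_eq]
  obtain ⟨e, hae⟩ : ∃ e : ℕ, a' + n = e := ⟨_, rfl⟩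
  obtain ⟨m, rfl⟩ : ∃ m, N = e + 1 + m := ⟨N - e - 1, by omega⟩
  haveI : IsProbabilityMeasure (P.gibbsMeasure (e + 1 + m) T) :=
    pinnedChain_isProbabilityMeasure_gibbsMeasure hω hl.le hβ.le γ _ hT
  refine ⟨?_, fun t' ht' => ?_⟩
  · -- ### the pinning term
    rcases Nat.lt_or_ge t.val (e + 1) with hte | hte
    · -- at the last window site: Cauchy–Schwarz fallback (`d = 0`)
      have hd : d = 0 := by omega
      subst hd
      rw [pow_zero, mul_one]
      refine le_trans ?_ (le_max_left _ _)
      obtain ⟨-, hI2, hIK⟩ := hKGw (e + 1 + m) a' (by omega)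
      have hGc : Continuous fun z : PhaseSpace (e + 1 + m) => g fun jj : Fin (n + 1) =>
          (z.1 ⟨a' + jj.val, by omega⟩, z.2 ⟨a' + jj.val, by omega⟩) :=
        hg.comp (continuous_pi fun jj =>
          ((continuous_apply _).comp continuous_fst).prodMk ((continuous_apply _).comp continuous_snd))
      have hGm : MemLp (fun z : PhaseSpace (e + 1 + m) => g fun jj : Fin (n + 1) =>
          (z.1 ⟨a' + jj.val, by omega⟩, z.2 ⟨a' + jj.val, by omega⟩)) 2 (P.gibbsMeasure (e + 1 + m) T) :=
        (memLp_two_iff_integrable_sq hGc.aestronglyMeasurable).2 hI2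
      obtain ⟨hUm, hUK⟩ := hKU (e + 1 + m) t
      exact abs_integral_mul_sub_le_two_mul_sqrt hGm hUm hIK hUK
    · -- to the right of the window: the transfer-operator bound
      have hjm : t.val - e - 1 < m := by omega
      have htj : t = Fin.natAdd (e + 1) ⟨t.val - e - 1, hjm⟩ := Fin.ext (by simp; omega)
      have happ : ∀ (ξ : Fin (e + 1) → ℝ × ℝ) (η : Fin m → ℝ × ℝ),
          Fin.append ξ η t = η ⟨t.val - e - 1, hjm⟩ := by
        intro ξ η
        have h1 := Fin.append_right ξ η ⟨t.val - e - 1, hjm⟩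
        rw [← htj] at h1
        exact h1
      have key := pinnedChain_abs_cov_window_insertion_le (ρ := ρ) hω hl.le hβ.le hT ha hK₀ hk hw hρ
        ham hab hkCb (ins := fun _ y => P.U y.1) hkUc.measurable hkUCb hA hHU hφ1 hlam₀ hθ0 hθ.le
        hpow hzs0 hz hg hgb hKG0 (fun M i h => (hKGw M i h).2.2) a' e m hae ⟨t.val - e - 1, hjm⟩
        (Ins := fun z : PhaseSpace (e + 1 + m) => P.U (z.1 t))
        ((SpecificHeatLimit.pinnedChain_continuous_U γ).comp ((continuous_apply t).comp continuous_fst))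
        (pinnedChain_abs_U_apply_le (β := β) hω.le hl.le γ t)
        (fun ξ η => by
          show P.U ((Fin.append ξ η t).1) = P.U (η ⟨t.val - e - 1, hjm⟩).1
          rw [happ])
      exact key.trans (hfeed HU (t.val - e - 1) d (le_max_left _ _) (by omega))
  · -- ### the bond term
    have hjm : t.val - e < m := by omega
    have ht'j : t' = Fin.natAdd (e + 1) ⟨t.val - e, hjm⟩ := Fin.ext (by simp; omega)
    have htj : t = ⟨e + (⟨t.val - e, hjm⟩ : Fin m).val, by simp; omega⟩ := Fin.ext (by simp; omega)
    have happ' : ∀ (ξ : Fin (e + 1) → ℝ × ℝ) (η : Fin m → ℝ × ℝ),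
        Fin.append ξ η t' = η ⟨t.val - e, hjm⟩ := by
      intro ξ η
      have h1 := Fin.append_right ξ η ⟨t.val - e, hjm⟩
      rw [← ht'j] at h1
      exact h1
    have happ : ∀ (ξ : Fin (e + 1) → ℝ × ℝ) (η : Fin m → ℝ × ℝ),
        Fin.append ξ η t = (Fin.cons (ξ (Fin.last e)) η : Fin (m + 1) → ℝ × ℝ)
          (Fin.castSucc ⟨t.val - e, hjm⟩) := by
      intro ξ η
      have h2 := append_apply_eq_cons_castSucc e m ξ η ⟨t.val - e, hjm⟩ (by simp; omega)
      rw [← htj] at h2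
      exact h2
    have key := pinnedChain_abs_cov_window_insertion_le (ρ := ρ) hω hl.le hβ.le hT ha hK₀ hk hw hρ
      ham hab hkCb (ins := fun x y => P.V (y.1 - x.1)) hkVc.measurable hkVCb hA hHV hφ1 hlam₀ hθ0 hθ.le
      hpow hzs0 hz hg hgb hKG0 (fun M i h => (hKGw M i h).2.2) a' e m hae ⟨t.val - e, hjm⟩
      (Ins := fun z : PhaseSpace (e + 1 + m) => P.V (z.1 t' - z.1 t))
      ((SpecificHeatLimit.pinnedChain_continuous_V γ).comp
        (((continuous_apply t').comp continuous_fst).sub ((continuous_apply t).comp continuous_fst)))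
      (pinnedChain_abs_V_apply_le (ω₂ := ω₂) (lam := lam) hβ.le γ t t')
      (fun ξ η => by
        show P.V ((Fin.append ξ η t').1 - (Fin.append ξ η t).1) =
          P.V ((η ⟨t.val - e, hjm⟩).1 - ((Fin.cons (ξ (Fin.last e)) η : Fin (m + 1) → ℝ × ℝ)
            (Fin.castSucc ⟨t.val - e, hjm⟩)).1)
        rw [happ', happ])
    exact key.trans (hfeed HV (t.val - e) d (le_max_right _ _) (by omega))

end Summit.AtomisticToContinuum.FouriersLaw.Theorems.LocalOhmBirth

end
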